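import Mathlib
import Literature.NumberTheory.LFunctions.Zhang2022.TypedSection13
import Literature.NumberTheory.LFunctions.Zhang2022.SkeletonAssembly
import Literature.NumberTheory.LFunctions.Zhang2022.Section5VerticalShift
import HarnessLib

/-!
# Zhang (2022) §13, the "by Lemma 5.1" step after (13.1): `Z(ρ+β₃,ψ)⁻¹ = Z(ρ+β₂,ψ)⁻¹(pt₀)^{β₁} + O(𝓛⁻¹²³)`
# — kernel-checked as an EDGE from Proposition 2.2 (i)

Topic `Literature/NumberTheory/LFunctions/Zhang2022` (Landau–Siegel audit tree; verdict-neutral).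
Y. Zhang, *Discrete mean estimates and the Landau–Siegel zero*, arXiv:2211.02515v1 (2022)
[Zhang2022LandauSiegel], §13 p. 74, second display after (13.1) (tex L3744–3746):

> and, by Lemma 5.1, `Z(ρ+β₃,ψ)⁻¹ = Z(ρ+β₂,ψ)⁻¹(pt₀)^{β₁} + O(𝓛⁻¹²³)`

(`ψ ∈ Ψ₁`, `ρ ∈ 𝔷(ψ)`, `p = p_ψ`; `β₃ − β₂ = β₁` by (2.13)). Campaign D-0069 (IUT playbook #2),
DAG node `Z22:§13.u002`, typed statement-exact as `Typed.Section13.U002 c′` (`TypedSection13.lean`,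
p411917), with an ABSOLUTE error `C𝓛⁻¹²³`.

**What is proved.** `Typed.Section13.u002_of_prop22i : Skeleton.Prop22i → ∀ c′, U002 c′`. The only
manuscript input is Proposition 2.2 (i) (`Skeleton.Prop22i`, a CLAIM leaf of the cone: for
`ψ ∈ Ψ₁` the zeros of `L(s,ψ)L(s,ψχ)` in `Ω` lie on `σ = 1/2`), which is what makes the absolute
error possible (`|Z(ρ,ψ)| = 1` on the critical line; off the line `|Z(ρ,ψ)⁻¹|` is as large as
`P^{σ−1/2}`). "By Lemma 5.1" is replaced by the tree's EXACT vertical shift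
`GammaFactor.Zfac_vertical_shift` (`Z(s+iv) = Z(s)e^{−iv·log(pt/2π)}e^{η}`, `‖η‖ ≤ (2|v|+14)|v|/t`)
at `v = v₂, v₃` (`β_j = iv_j`), the exact identity `v₁ + v₂ = v₃`, and the elementary estimate
`|log(pt₀) − log(pt/2π)| = |log(2πt₀/t)| ≤ 2𝓛₁/(2πt₀)` for `|t − 2πt₀| < 𝓛₁`, so that the
`(pt₀)^{β₁}`-versus-`(pt/2π)^{β₁}` discrepancy is `≤ |v₁|𝓛₁/(πt₀) ≤ (1+5π|c′|)·α𝓛₁/(πt₀)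
= (1+5π|c′|)𝓛⁻¹²³` EXACTLY (`α = π𝓛⁻⁹`, `𝓛₁ = 𝓛⁴⁰⁵`, `t₀ = 𝓛⁵¹⁹`; `9 + 519 − 405 = 123`).
No Assumption (A) is used; 0 new facts.

WHAT THIS IS NOT: a proof of Proposition 2.2 or Lemma 5.1 themselves; any claim about Theorems 1–2
of the manuscript or about Landau–Siegel zeros.

## References

* Y. Zhang, arXiv:2211.02515v1 (2022), §13 p. 74 (display after (13.1)); §5 Lemma 5.1 p. 24;
  §2 (2.13), Prop. 2.2 (i). [cite: Zhang2022LandauSiegel, §13 p.74]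
-/

noncomputable section

open Complex Real ComplexConjugate

namespace Literature.NumberTheory.LFunctions.Zhang2022.Typed.Section13

open Skeleton GammaFactor

/-! ## Parameter bookkeeping -/

/-- `β₁ = iv₁`, `v₁ = α(1−5c′α𝓛)`. [cite: Zhang2022LandauSiegel, §2 (2.13)] -/
private theorem beta1_eq' (c' : ℝ) (D : ℕ) :
    beta1 c' D = ((alpha D * (1 - 5 * c' * alpha D * ell D) : ℝ) : ℂ) * I := by
  simp only [beta1]; push_cast; ring

/-- `β₂ = iv₂`, `v₂ = 2α(1+c′α𝓛)`. [cite: Zhang2022LandauSiegel, §2 (2.13)] -/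
private theorem beta2_eq' (c' : ℝ) (D : ℕ) :
    beta2 c' D = ((2 * alpha D * (1 + c' * alpha D * ell D) : ℝ) : ℂ) * I := by
  simp only [beta2]; push_cast; ring

/-- `β₃ = iv₃`, `v₃ = 3α(1−c′α𝓛)`. [cite: Zhang2022LandauSiegel, §2 (2.13)] -/
private theorem beta3_eq' (c' : ℝ) (D : ℕ) :
    beta3 c' D = ((3 * alpha D * (1 - c' * alpha D * ell D) : ℝ) : ℂ) * I := by
  simp only [beta3]; push_cast; ring

/-- `α = π/𝓛⁹` ((2.10), `P = exp 𝓛⁹`). [cite: Zhang2022LandauSiegel, §2 (2.10)] -/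
private theorem alpha_eq' (D : ℕ) : alpha D = π / ell D ^ 9 := by
  rw [alpha, bigP, Real.log_exp]

/-- For `𝓛 ≥ 1`: `0 < α ≤ π` and `0 ≤ α𝓛 ≤ π`. [cite: Zhang2022LandauSiegel, §2 (2.10)] -/
private theorem alpha_bounds' {D : ℕ} (hℓ : 1 ≤ ell D) :
    0 < alpha D ∧ alpha D ≤ π ∧ 0 ≤ alpha D * ell D ∧ alpha D * ell D ≤ π := by
  have h9 : 1 ≤ ell D ^ 9 := one_le_pow₀ hℓ
  have hα : alpha D = π / ell D ^ 9 := alpha_eq' D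
  have hαpos : 0 < alpha D := by rw [hα]; positivity
  have hαle : alpha D ≤ π := by
    rw [hα]; exact div_le_self pi_pos.le h9
  have h8 : ell D ≤ ell D ^ 9 := by
    calc ell D = ell D ^ 1 := (pow_one _).symm
      _ ≤ ell D ^ 9 := pow_le_pow_right₀ hℓ (by norm_num)
  refine ⟨hαpos, hαle, by positivity, ?_⟩
  calc alpha D * ell D ≤ alpha D * ell D ^ 9 := by gcongr
    _ = π := by rw [hα, div_mul_cancel₀ _ (by positivity)]

/-- `|a(1 ± b)| ≤ a(1 + |b|)` for `a ≥ 0`. [folklore] -/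
private theorem abs_mul_one_addsub_le {a b : ℝ} (ha : 0 ≤ a) :
    |a * (1 - b)| ≤ a * (1 + |b|) ∧ |a * (1 + b)| ≤ a * (1 + |b|) := by
  rw [abs_mul, abs_mul, abs_of_nonneg ha]
  constructor
  · gcongr
    calc |1 - b| ≤ |1| + |b| := abs_sub _ _
      _ = 1 + |b| := by rw [abs_one]
  · gcongr
    calc |1 + b| ≤ |1| + |b| := abs_add_le _ _
      _ = 1 + |b| := by rw [abs_one]

/-- The `|v_j|` bounds: `|v₁| ≤ α(1+5π|c′|)`, and `|v₂|, |v₃| ≤ V(c′) = 3π(1+5π|c′|)` (`𝓛 ≥ 1`).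
[cite: Zhang2022LandauSiegel, §2 (2.13)] -/
private theorem abs_v_le' {c' : ℝ} {D : ℕ} (hℓ : 1 ≤ ell D) :
    |alpha D * (1 - 5 * c' * alpha D * ell D)| ≤ alpha D * (1 + 5 * π * |c'|) ∧
      |2 * alpha D * (1 + c' * alpha D * ell D)| ≤ 3 * π * (1 + 5 * π * |c'|) ∧
      |3 * alpha D * (1 - c' * alpha D * ell D)| ≤ 3 * π * (1 + 5 * π * |c'|) := by
  obtain ⟨hαpos, hαle, hαℓ0, hαℓ⟩ := alpha_bounds' hℓ
  have hc : 0 ≤ |c'| := abs_nonneg _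
  have hπ : 0 ≤ π := pi_pos.le
  have hb5 : |5 * c' * alpha D * ell D| ≤ 5 * π * |c'| := by
    rw [show 5 * c' * alpha D * ell D = 5 * c' * (alpha D * ell D) by ring, abs_mul, abs_mul,
      abs_of_nonneg (by norm_num : (0 : ℝ) ≤ 5), abs_of_nonneg hαℓ0]
    calc 5 * |c'| * (alpha D * ell D) ≤ 5 * |c'| * π := by gcongr
      _ = 5 * π * |c'| := by ring
  have hb1 : |c' * alpha D * ell D| ≤ π * |c'| := by
    rw [show c' * alpha D * ell D = c' * (alpha D * ell D) by ring, abs_mul, abs_of_nonneg hαℓ0]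
    calc |c'| * (alpha D * ell D) ≤ |c'| * π := by gcongr
      _ = π * |c'| := by ring
  refine ⟨?_, ?_, ?_⟩
  · calc |alpha D * (1 - 5 * c' * alpha D * ell D)| ≤ alpha D * (1 + |5 * c' * alpha D * ell D|) :=
          (abs_mul_one_addsub_le hαpos.le).1
      _ ≤ alpha D * (1 + 5 * π * |c'|) := by gcongr
  · calc |2 * alpha D * (1 + c' * alpha D * ell D)| ≤ 2 * alpha D * (1 + |c' * alpha D * ell D|) :=
          (abs_mul_one_addsub_le (by positivity)).2
      _ ≤ 2 * π * (1 + π * |c'|) := by gcongr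
      _ ≤ 3 * π * (1 + 5 * π * |c'|) := by nlinarith [mul_nonneg hπ hc]
  · calc |3 * alpha D * (1 - c' * alpha D * ell D)| ≤ 3 * alpha D * (1 + |c' * alpha D * ell D|) :=
          (abs_mul_one_addsub_le (by positivity)).1
      _ ≤ 3 * π * (1 + π * |c'|) := by gcongr
      _ ≤ 3 * π * (1 + 5 * π * |c'|) := by nlinarith [mul_nonneg hπ hc]

/-- `|log u| ≤ 2|u − 1|` for `|u − 1| ≤ 1/2`. [folklore] -/
private theorem abs_log_le_two_mul {u : ℝ} (hu : |u - 1| ≤ 1 / 2) : |Real.log u| ≤ 2 * |u - 1| := by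
  have hu1 := (abs_le.mp hu).1
  have hupos : 0 < u := by linarith
  have hup : Real.log u ≤ u - 1 := Real.log_le_sub_one_of_pos hupos
  have hlow : 1 - u⁻¹ ≤ Real.log u := Real.one_sub_inv_le_log_of_pos hupos
  have habs : |u - 1| ≥ 0 := abs_nonneg _
  rw [abs_le]
  constructor
  · -- `−2|u−1| ≤ 1 − 1/u ≤ log u`
    have h2 : -(2 * |u - 1|) ≤ 1 - u⁻¹ := by
      have hu_half : 1 / 2 ≤ u := by linarith
      have : 1 - u⁻¹ = (u - 1) / u := by field_simp
      rw [this, le_div_iff₀ hupos]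
      have := neg_abs_le (u - 1)
      nlinarith [abs_nonneg (u - 1)]
    linarith
  · linarith [le_abs_self (u - 1)]

/-- The exponent of record: `α𝓛₁/(πt₀) = 𝓛⁻¹²³` (`α = π𝓛⁻⁹`, `𝓛₁ = 𝓛⁴⁰⁵`, `t₀ = 𝓛⁵¹⁹`).
[cite: Zhang2022LandauSiegel, §5 Lemma 5.1; §2 (2.8), (2.10)] -/
private theorem alpha_ell1_div {D : ℕ} (hℓ : (0 : ℝ) < ell D) :
    alpha D * ell1 D / (π * t0 D) = (ell D ^ 123)⁻¹ := by
  rw [alpha_eq', ell1, t0]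
  have hπ : (π : ℝ) ≠ 0 := pi_pos.ne'
  have hℓ0 : ell D ≠ 0 := hℓ.ne'
  field_simp

/-! ## The edge -/

/-- **`Z22:§13.u002` as a kernel-checked EDGE from Proposition 2.2 (i)** [Z22 p.74, second display
after (13.1), tex L3744–3746]: `Skeleton.Prop22i → Typed.Section13.U002 c′` for every `c′`, i.e.
for `D` large, `ψ ∈ Ψ₁`, `ρ ∈ 𝔷(ψ)`:
`‖Z(ρ+β₃,ψ)⁻¹ − Z(ρ+β₂,ψ)⁻¹(pt₀)^{β₁}‖ ≤ C𝓛⁻¹²³`, `C = 4(2V+14)V + 2(1+5π|c′|)`,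
`V = 3π(1+5π|c′|)`. "By Lemma 5.1" is the tree's exact `GammaFactor.Zfac_vertical_shift`; the one
manuscript input is `Re ρ = 1/2` (Prop. 2.2 (i), `|Z(ρ,ψ)| = 1`).
[cite: Zhang2022LandauSiegel, §13 p.74] -/
theorem u002_of_prop22i (h22 : Prop22i) (c' : ℝ) : U002 c' := by
  -- constants
  set V : ℝ := 3 * π * (1 + 5 * π * |c'|) with hV
  set K : ℝ := 1 + 5 * π * |c'| with hK
  set W : ℝ := (2 * V + 14) * V with hW
  set M : ℝ := 4 + 2 * V + W + K with hM
  have hK1 : 1 ≤ K := by rw [hK]; nlinarith [pi_pos, abs_nonneg c']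
  have hV0 : 0 ≤ V := by positivity
  have hW0 : 0 ≤ W := by positivity
  obtain ⟨D₁, h22⟩ := h22
  refine ⟨4 * W + 2 * K, max D₁ ⌈Real.exp M⌉₊, fun D _ χ hD hq hp _ x hx ρ hρ => ?_⟩
  have hD₁ : D₁ ≤ D := le_trans (le_max_left _ _) hD
  have hD₂ : ⌈Real.exp M⌉₊ ≤ D := le_trans (le_max_right _ _) hD
  -- `Re ρ = 1/2` from Prop. 2.2 (i)
  have hre : ρ.re = 1 / 2 := h22 D χ hD₁ hq hp x hx ρ (mem_prodZeroSetOmega_of_mem_zeroSet χ hρ)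
  -- `𝓛 ≥ M`
  have hDreal : Real.exp M ≤ (D : ℝ) := le_trans (Nat.le_ceil _) (by exact_mod_cast hD₂)
  have hDpos : (0 : ℝ) < D := lt_of_lt_of_le (Real.exp_pos M) hDreal
  have hℓM : M ≤ ell D := by rw [ell]; exact (Real.le_log_iff_exp_le hDpos).mpr hDreal
  have hM4 : 4 ≤ M := by rw [hM]; linarith
  have hℓ1 : 1 ≤ ell D := by linarith
  have hℓpos : 0 < ell D := by linarith
  have ht0ℓ : ell D ≤ t0 D := by rw [t0]; exact le_self_pow₀ hℓ1 (by norm_num)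
  have ht0M : M ≤ t0 D := le_trans hℓM ht0ℓ
  have ht0pos : 0 < t0 D := by linarith
  have hℓ1pos : 0 < ell1 D := by rw [ell1]; exact pow_pos hℓpos _
  have hℓ1t0 : ell1 D ≤ t0 D := by
    rw [ell1, t0]; exact pow_le_pow_right₀ hℓ1 (by norm_num)
  -- the zero `ρ = 1/2 + it`
  obtain ⟨-, him, -⟩ := hρ
  set t : ℝ := ρ.im with ht
  have hρeq : ρ = ((1 / 2 : ℝ) : ℂ) + t * I := by
    rw [← hre]; exact (Complex.re_add_im ρ).symm
  have htt0 : t0 D ≤ t := by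
    have h1 := (abs_lt.mp him).1
    have hπ : (3 : ℝ) < π := Real.pi_gt_three
    nlinarith
  have htpos : 0 < t := lt_of_lt_of_le ht0pos htt0
  have ht4 : 4 * (1 : ℝ) ≤ t := by linarith
  -- the shifts
  obtain ⟨hav1, hav2, hav3⟩ := abs_v_le' (c' := c') hℓ1
  obtain ⟨hαpos, hαle, -, -⟩ := alpha_bounds' hℓ1
  set v1 : ℝ := alpha D * (1 - 5 * c' * alpha D * ell D) with hv1
  set v2 : ℝ := 2 * alpha D * (1 + c' * alpha D * ell D) with hv2
  set v3 : ℝ := 3 * alpha D * (1 - c' * alpha D * ell D) with hv3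
  have hsum : v1 + v2 = v3 := by rw [hv1, hv2, hv3]; ring
  have hv1V : |v1| ≤ V := by
    calc |v1| ≤ alpha D * K := hav1
      _ ≤ π * K := by gcongr
      _ ≤ V := by rw [hV, hK]; nlinarith [pi_pos, abs_nonneg c']
  have h2Vt : 2 * V ≤ t := by linarith only [hℓM, hM, ht0ℓ, htt0, hW0, hK1]
  have hvt2 : |v2| ≤ t / 2 := by linarith only [hav2, h2Vt]
  have hvt3 : |v3| ≤ t / 2 := by linarith only [hav3, h2Vt]
  have hσ0 : (0 : ℝ) < 1 / 2 := by norm_num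
  have hσ1 : (1 / 2 : ℝ) ≤ 1 := by norm_num
  obtain ⟨η₂, hη₂, hZ2⟩ := Zfac_vertical_shift x.prim le_rfl hσ0 hσ1 ht4 hvt2
  obtain ⟨η₃, hη₃, hZ3⟩ := Zfac_vertical_shift x.prim le_rfl hσ0 hσ1 ht4 hvt3
  set s : ℂ := ((1 / 2 : ℝ) : ℂ) + t * I with hs
  set L : ℂ := ((Real.log ((x.p : ℝ) * t / (2 * π)) : ℝ) : ℂ) with hL
  set Z0 : ℂ := Zfac x.ψ s with hZ0
  have hsIm : 0 < s.im := by rw [hs]; simpa using htpos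
  have hZ0ne : Z0 ≠ 0 := Zfac_ne_zero x.prim hsIm
  have hZ0norm : ‖Z0‖ = 1 := by
    rw [hZ0, hs]
    have : ((1 / 2 : ℝ) : ℂ) + t * I = 1 / 2 + t * I := by push_cast; ring
    rw [this]; exact norm_Zfac_half_eq_one x.prim htpos
  -- `‖η_j‖ ≤ W/t ≤ W/t₀`, and `≤ 1`
  have hquad : ∀ a : ℝ, |a| ≤ V → (2 * |a| + 4 * 1 + 10) * |a| / t ≤ W / t := by
    intro a ha
    apply div_le_div_of_nonneg_right _ htpos.le
    have h0 : 0 ≤ |a| := abs_nonneg _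
    rw [hW]; nlinarith only [ha, h0, hV0, mul_le_mul ha ha h0 hV0]
  have hWt : W / t ≤ W / t0 D := div_le_div_of_nonneg_left hW0 ht0pos htt0
  have hWt1 : W / t ≤ 1 := by
    refine le_trans hWt ?_
    rw [div_le_one ht0pos]; linarith only [ht0M, hM, hV0, hK1]
  have hη₂' : ‖η₂‖ ≤ W / t := le_trans hη₂ (hquad v2 hav2)
  have hη₃' : ‖η₃‖ ≤ W / t := le_trans hη₃ (hquad v3 hav3)
  -- the `(pt₀)^{β₁}` factor
  have hb : 0 < (x.p : ℝ) * t0 D := mul_pos (Nat.cast_pos.mpr x.prime.pos) ht0pos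
  set L₀ : ℝ := Real.log ((x.p : ℝ) * t0 D) with hL₀
  have hpow : ((((x.p : ℝ) * t0 D : ℝ)) : ℂ) ^ beta1 c' D = cexp (((v1 * L₀ : ℝ)) * I) := by
    rw [Complex.cpow_def_of_ne_zero (by exact_mod_cast hb.ne'), ← Complex.ofReal_log hb.le,
      beta1_eq']
    congr 1
    rw [hv1, hL₀]; push_cast; ring
  -- the two inverses
  have hβ2 : ρ + beta2 c' D = ((1 / 2 : ℝ) : ℂ) + t * I + (v2 : ℂ) * I := by rw [beta2_eq', hρeq]
  have hβ3 : ρ + beta3 c' D = ((1 / 2 : ℝ) : ℂ) + t * I + (v3 : ℂ) * I := by rw [beta3_eq', hρeq]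
  have hexp_cancel : ∀ w : ℂ, cexp (-w * I) * cexp (w * I) = 1 := by
    intro w; rw [← Complex.exp_add, show -w * I + w * I = 0 by ring, Complex.exp_zero]
  have hinv3 : (Zfac x.ψ (ρ + beta3 c' D))⁻¹ = Z0⁻¹ * cexp ((v3 : ℂ) * L * I) * cexp (-η₃) := by
    rw [hβ3, hZ3]
    apply inv_eq_of_mul_eq_one_right
    calc Z0 * cexp (-((v3 : ℂ) * L) * I) * cexp η₃ * (Z0⁻¹ * cexp ((v3 : ℂ) * L * I) * cexp (-η₃))
        = (Z0 * Z0⁻¹) * (cexp (-((v3 : ℂ) * L) * I) * cexp ((v3 : ℂ) * L * I)) *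
            (cexp η₃ * cexp (-η₃)) := by ring
      _ = 1 := by
          rw [mul_inv_cancel₀ hZ0ne, hexp_cancel, ← Complex.exp_add, add_neg_cancel,
            Complex.exp_zero]; ring
  have hinv2 : (Zfac x.ψ (ρ + beta2 c' D))⁻¹ = Z0⁻¹ * cexp ((v2 : ℂ) * L * I) * cexp (-η₂) := by
    rw [hβ2, hZ2]
    apply inv_eq_of_mul_eq_one_right
    calc Z0 * cexp (-((v2 : ℂ) * L) * I) * cexp η₂ * (Z0⁻¹ * cexp ((v2 : ℂ) * L * I) * cexp (-η₂))
        = (Z0 * Z0⁻¹) * (cexp (-((v2 : ℂ) * L) * I) * cexp ((v2 : ℂ) * L * I)) *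
            (cexp η₂ * cexp (-η₂)) := by ring
      _ = 1 := by
          rw [mul_inv_cancel₀ hZ0ne, hexp_cancel, ← Complex.exp_add, add_neg_cancel,
            Complex.exp_zero]; ring
  -- the discrepancy angle `θ = v₁(L₀ − L)`
  set θ : ℝ := v1 * (L₀ - Real.log ((x.p : ℝ) * t / (2 * π))) with hθ
  have hsplit : cexp ((v2 : ℂ) * L * I) * cexp (((v1 * L₀ : ℝ)) * I) =
      cexp ((v3 : ℂ) * L * I) * cexp ((θ : ℂ) * I) := by
    rw [← Complex.exp_add, ← Complex.exp_add]
    congr 1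
    have hs' : (v3 : ℂ) = v1 + v2 := by rw [← hsum]; push_cast; ring
    rw [hs', hθ, hL]; push_cast; ring
  have hdiff : (Zfac x.ψ (ρ + beta3 c' D))⁻¹ -
      (Zfac x.ψ (ρ + beta2 c' D))⁻¹ * ((((x.p : ℝ) * t0 D : ℝ)) : ℂ) ^ beta1 c' D =
      Z0⁻¹ * cexp ((v3 : ℂ) * L * I) * (cexp (-η₃) - cexp (-η₂) * cexp ((θ : ℂ) * I)) := by
    rw [hinv3, hinv2, hpow]
    calc Z0⁻¹ * cexp ((v3 : ℂ) * L * I) * cexp (-η₃) -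
          Z0⁻¹ * cexp ((v2 : ℂ) * L * I) * cexp (-η₂) * cexp (((v1 * L₀ : ℝ)) * I)
        = Z0⁻¹ * cexp ((v3 : ℂ) * L * I) * cexp (-η₃) -
          Z0⁻¹ * (cexp ((v2 : ℂ) * L * I) * cexp (((v1 * L₀ : ℝ)) * I)) * cexp (-η₂) := by ring
      _ = _ := by rw [hsplit]; ring
  -- `|θ| ≤ K 𝓛⁻¹²³`
  have hθ_le : |θ| ≤ K * (ell D ^ 123)⁻¹ := by
    have hp0 : (0 : ℝ) < x.p := Nat.cast_pos.mpr x.prime.pos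
    have h2π : (0 : ℝ) < 2 * π := mul_pos two_pos pi_pos
    have h2πt0 : (0 : ℝ) < 2 * π * t0 D := mul_pos h2π ht0pos
    set u : ℝ := t / (2 * π * t0 D) with hu
    have hupos : 0 < u := div_pos htpos h2πt0
    have hlog : L₀ - Real.log ((x.p : ℝ) * t / (2 * π)) = -Real.log u := by
      rw [hL₀, hu, Real.log_div (mul_pos hp0 htpos).ne' h2π.ne', Real.log_mul hp0.ne' ht0pos.ne',
        Real.log_mul hp0.ne' htpos.ne', Real.log_div htpos.ne' h2πt0.ne',
        Real.log_mul h2π.ne' ht0pos.ne']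
      ring
    have hu1 : |u - 1| ≤ ell1 D / (2 * π * t0 D) := by
      have hne : 2 * π * t0 D ≠ 0 := h2πt0.ne'
      have : u - 1 = (t - 2 * π * t0 D) / (2 * π * t0 D) := by
        rw [hu]; field_simp
      rw [this, abs_div, abs_of_pos h2πt0]
      exact div_le_div_of_nonneg_right him.le h2πt0.le
    have hu_half : |u - 1| ≤ 1 / 2 := by
      refine le_trans hu1 ?_
      rw [div_le_iff₀ h2πt0]
      have hπ3 : (3 : ℝ) < π := Real.pi_gt_three
      have h1 : t0 D ≤ π * t0 D := le_mul_of_one_le_left ht0pos.le (by linarith only [hπ3])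
      linarith only [hℓ1t0, h1]
    have hlogu : |Real.log u| ≤ 2 * (ell1 D / (2 * π * t0 D)) :=
      le_trans (abs_log_le_two_mul hu_half) (mul_le_mul_of_nonneg_left hu1 zero_le_two)
    have hπ0 : (π : ℝ) ≠ 0 := pi_pos.ne'
    have ht00 : t0 D ≠ 0 := ht0pos.ne'
    have halg : (alpha D * K) * (2 * (ell1 D / (2 * π * t0 D))) =
        K * (alpha D * ell1 D / (π * t0 D)) := by
      field_simp
    calc |θ| = |v1| * |Real.log u| := by rw [hθ, hlog, abs_mul, abs_neg]
      _ ≤ (alpha D * K) * (2 * (ell1 D / (2 * π * t0 D))) :=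
          mul_le_mul hav1 hlogu (abs_nonneg _) (mul_nonneg hαpos.le (by linarith only [hK1]))
      _ = K * (alpha D * ell1 D / (π * t0 D)) := halg
      _ = K * (ell D ^ 123)⁻¹ := by rw [alpha_ell1_div hℓpos]
  have hθ1 : ‖((θ : ℂ)) * I‖ ≤ 1 := by
    rw [norm_mul, Complex.norm_I, mul_one, Complex.norm_real, Real.norm_eq_abs]
    refine le_trans hθ_le ?_
    have h123 : ell D ≤ ell D ^ 123 := le_self_pow₀ hℓ1 (by norm_num)
    have : K ≤ ell D ^ 123 := by linarith only [h123, hℓM, hM, hV0, hW0]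
    rw [← div_eq_mul_inv, div_le_one (pow_pos hℓpos 123)]; exact this
  -- norms of the three small factors
  have hA : ‖cexp (-η₃) - 1‖ ≤ 2 * (W / t) := by
    calc ‖cexp (-η₃) - 1‖ ≤ 2 * ‖-η₃‖ :=
          Complex.norm_exp_sub_one_le (by rw [norm_neg]; exact hη₃'.trans hWt1)
      _ ≤ 2 * (W / t) := by rw [norm_neg]; exact mul_le_mul_of_nonneg_left hη₃' zero_le_two
  have hB : ‖cexp (-η₂) - 1‖ ≤ 2 * (W / t) := by
    calc ‖cexp (-η₂) - 1‖ ≤ 2 * ‖-η₂‖ :=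
          Complex.norm_exp_sub_one_le (by rw [norm_neg]; exact hη₂'.trans hWt1)
      _ ≤ 2 * (W / t) := by rw [norm_neg]; exact mul_le_mul_of_nonneg_left hη₂' zero_le_two
  have hC : ‖cexp ((θ : ℂ) * I) - 1‖ ≤ 2 * (K * (ell D ^ 123)⁻¹) := by
    calc ‖cexp ((θ : ℂ) * I) - 1‖ ≤ 2 * ‖(θ : ℂ) * I‖ := Complex.norm_exp_sub_one_le hθ1
      _ ≤ 2 * (K * (ell D ^ 123)⁻¹) := by
          rw [norm_mul, Complex.norm_I, mul_one, Complex.norm_real, Real.norm_eq_abs]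
          exact mul_le_mul_of_nonneg_left hθ_le zero_le_two
  have hθnorm : ‖cexp ((θ : ℂ) * I)‖ = 1 := Complex.norm_exp_ofReal_mul_I θ
  have hv3L : ‖cexp ((v3 : ℂ) * L * I)‖ = 1 := by
    have : (v3 : ℂ) * L * I = ((v3 * Real.log ((x.p : ℝ) * t / (2 * π)) : ℝ) : ℂ) * I := by
      rw [hL]; push_cast; ring
    rw [this]; exact Complex.norm_exp_ofReal_mul_I _
  -- assemble
  rw [hdiff, norm_mul, norm_mul, norm_inv, hZ0norm, hv3L, inv_one, one_mul, one_mul]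
  have hkey : cexp (-η₃) - cexp (-η₂) * cexp ((θ : ℂ) * I) =
      (cexp (-η₃) - 1) - (cexp (-η₂) - 1) * cexp ((θ : ℂ) * I) - (cexp ((θ : ℂ) * I) - 1) := by
    ring
  rw [hkey]
  have hinv0 : 0 ≤ (ell D ^ 123)⁻¹ := inv_nonneg.mpr (pow_nonneg hℓpos.le _)
  have h123 : (t0 D)⁻¹ ≤ (ell D ^ 123)⁻¹ := by
    have : ell D ^ 123 ≤ t0 D := by rw [t0]; exact pow_le_pow_right₀ hℓ1 (by norm_num)
    exact inv_anti₀ (pow_pos hℓpos 123) this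
  have hWt0 : W / t ≤ W * (ell D ^ 123)⁻¹ := by
    calc W / t ≤ W / t0 D := hWt
      _ = W * (t0 D)⁻¹ := div_eq_mul_inv _ _
      _ ≤ W * (ell D ^ 123)⁻¹ := by gcongr
  calc ‖(cexp (-η₃) - 1) - (cexp (-η₂) - 1) * cexp ((θ : ℂ) * I) - (cexp ((θ : ℂ) * I) - 1)‖
      ≤ ‖(cexp (-η₃) - 1) - (cexp (-η₂) - 1) * cexp ((θ : ℂ) * I)‖ + ‖cexp ((θ : ℂ) * I) - 1‖ :=
        norm_sub_le _ _
    _ ≤ ‖cexp (-η₃) - 1‖ + ‖(cexp (-η₂) - 1) * cexp ((θ : ℂ) * I)‖ + ‖cexp ((θ : ℂ) * I) - 1‖ := by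
        gcongr; exact norm_sub_le _ _
    _ = ‖cexp (-η₃) - 1‖ + ‖cexp (-η₂) - 1‖ + ‖cexp ((θ : ℂ) * I) - 1‖ := by
        rw [norm_mul, hθnorm, mul_one]
    _ ≤ 2 * (W / t) + 2 * (W / t) + 2 * (K * (ell D ^ 123)⁻¹) := by gcongr
    _ ≤ 2 * (W * (ell D ^ 123)⁻¹) + 2 * (W * (ell D ^ 123)⁻¹) + 2 * (K * (ell D ^ 123)⁻¹) := by
        gcongr
    _ = (4 * W + 2 * K) * (ell D ^ 123)⁻¹ := by ring

end Literature.NumberTheory.LFunctions.Zhang2022.Typed.Section13
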